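import Summits.QuantumFields.BalabanUV.Beta.GAN24.CombTowerEndOfSlots
import Summits.QuantumFields.BalabanUV.Beta.GAN24.WSlotParityJunction

/-!
# `BalabanUV.Beta.GAN24.CombChartSlotJunction` — row G-an2-4 AT ROW D1's LITERAL OF RECORD (III′) `CombChartJointEnd.JsB12CombShSym`:
# LINK L7 OF THE (α-0) CHAIN — THE (III′) END's SLOT SOCKET ASKS THE W-SLOT ROWS OF THE EVEN HALF `½ • (W⁰_j + sgnK∘trK∘W⁰_j)` ONLY
# (the (III′) twin of the leaf-01 lineage's L7 `GAN24.WSlotParityJunction` §2–§3 on the OWNER gan24-p1 g46's (III′) socket `GAN24.CombTowerEndOfSlots` §5;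
# G-an2-4 formalisation swarm, leaf-01 gen 79; OWNER memo `TRANSFER-III-SIZING` v0.7 §3(a) «SLOT THE CHAIN»)

HONEST DEPENDENCY (page 1, mandatory): continuum YM on T⁴ ⇐ BetaPertH ∧ nine spine estimates (0/9 proved); BetaPertH ⇐ (D1) ∧ (D4) ∧
CAP+tail; G-an2-4 gates asym, D1 and NE2/3/4.  HONEST FRAMING (cell contract, verbatim): «discharging `BetaPertH` makes Bałaban's UV
stability UNCONDITIONAL — a real constructive-QFT result; it is NOT the continuum limit and NOT the Clay problem.»  THIS MODULE DISCHARGES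
NOTHING of the wall and NOTHING of row D1: [folklore] composition BY NAME — the OWNER's `CombTowerEndOfSlots.exists_allScalesSeq_JsB12CombShSym_of_kRows_slots_parity`
(L1 at (III′): the D1 consumer of the comb-chart tower is blind to ANY localised row-parity-odd family `X`) at `X_j :=` the ODD HALF of the comb-chart table
`W⁰_j = WcombOf tabs Lc⁴ (−Lc⁸∕2) cΛ Lc⁸ cB ((8N²)⁻¹ • wsym22 N) j`, slice by slice, whose two rows are L7's `WSlotParityJunction.loc_oddHalf_slice` (from an2's own
certificate `CombChartStepJets.vertexFamily₂_WcombOf`) and `parityOdd_oddHalf_slice` (hypothesis-free), with `W − X =` the even half by `sub_oddHalf_eq_evenHalf`;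
then the D1 lane's scalar sockets `HessKerDressedCauchy.d1Drift_iff_lim_eq` ∕ `D1BFx.RoadEnd.d1Drift_iff_cesaro`.  No `def`, no `Prop` minted, nothing printed asserted,
0 sorry.  EVERY ROW BELOW IS A HYPOTHESIS: the K-rows of `unitK_j (GcombSh Lc j)` are DISPLAYED in the shape of leaf-02 g77's `KSlotCombChart.kSlotCombSh_holds` (their
discharge is leaf-02's offered `CombTowerEndOfSlotsK`, journal W-2 l.64888 — not done here); the S-rows and the EVEN-HALF W-rows of the comb-chart slot families are the
(III′) campaign («T2Shape^{ev}» ∧ «T2Drift^{ev}» at the slot data `(tabs.V, tabs.H, GcombSh Lc, tabs.M, tabs.vh₂S, tabs.mixFF)`) and are NOT in the tree.  The (III′) END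
is NOT asked (an2 W-4 l.64553); this file removes the PARITY-JUNCTION letter (L7) from its cost list should it be asked.  NEVER «G-an2-4 closed» as (CONV-C); NOT D1,
NOT `BetaPertH`, NOT continuum, NOT Clay.

ABSOLUTE RULE (cell charter, verbatim): «No internally-minted statement may enter as a cited fact. Every hypothesis is either kernel-proved in
this package or a verbatim quotation of a PUBLISHED theorem with page reference. The manuscript(s) under audit are NOT citable for their own
disputed steps — they are the thing under adjudication; programme-internal (2001/route/tribunal) claims are never citable.»  Nothing is cited here.

## What is proved (literal of record `JsB12CombShSym hLc N tabs cΛ cB`, odd `Lc`, every `N tabs cΛ cB`, every channel; adopted units `sfStep Lc` ∕ `smStep 3 Lc`)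

* §1 **`exists_allScalesSeq_JsB12CombShSym_of_kRows_slots_evenHalf`** — K-rows of `unitK_j (GcombSh Lc j)` ∧ S-rows of `unitS_j (ScombOf tabs Lc⁴ (−Lc⁸∕2) cΛ j)` ∧
  W-rows of the EVEN HALF `unitW_j (½ • (W⁰_j + sgnK∘trK∘W⁰_j))` ⟹ `∃ κ θ, 0 ≤ θ < 1 ∧ AllScalesSeq (j ↦ secondMoment (TbalOf Lc (JsB12CombShSym …) j) μ ν) κ θ` —
  NOTHING asked of the odd half.  The (III′) twin of L7's `WSlotParityJunction.exists_allScalesSeq_JsRowD1_of_slots_evenHalf` (there the K-side is discharged inside by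
  road FP; here displayed).
* §2 the two D1-side readings with NO further letter: `d1Drift_JsB12CombShSym_iff_lim_eq_of_kRows_slots_evenHalf` (`D1Drift Lc (JsB12CombShSym …) Nc μ ν ↔ lim β = stepBal Nc Lc`)
  and `d1Drift_JsB12CombShSym_iff_cesaro_of_kRows_slots_evenHalf` (`↔ (Σ_{j<m} β_j)∕m → stepBal Nc Lc`).
WHAT IS NOT HERE: any ROW; the K-discharged corollaries (leaf-02's); the parity DICTIONARY saying that the odd half of `WcombOf` carries the (III′) Ward-locus residual
(road-P2's, on an ask); the even tower's autonomy ∕ shape ∕ drift at the (III′) slot data (L6 = the OWNER's `CombEvenTowerAutonomy`; L8 ∕ L9 twins open); any value.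
Unit `b2b-balaban-gan24-formalise-leaf-01` (gen 79); no existing file touched.
-/

open Finset Filter Topology
open scoped BigOperators
open Literature.MathematicalPhysics.QuantumFieldTheory
open Literature.MathematicalPhysics.QuantumFieldTheory.Balaban1983to89
open Literature.MathematicalPhysics.QuantumFieldTheory.Balaban1983to89.Beta
open RemainderConstAllScales (AllScalesSeq)
open ExpKernelCalculus (MKer Decays VertexFamily₂)
open OneStepResolventKernel (Fib LocStencil)
open OneStepKernelFamily (TbalOf D1Drift)
open WilsonVertex2Sym (wsym22)
open HessKerDressedCauchy (d1Drift_iff_lim_eq)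
open Summit.QuantumFields.BalabanUV.Beta.TameKernelCalculus (trK)
open Summit.QuantumFields.BalabanUV.Beta.BorderedHessian (sgnK)
open Summit.QuantumFields.BalabanUV.Beta.HessKerDressedUnits (unitK unitS unitW)
open Summit.QuantumFields.BalabanUV.Beta.SymmetrisedStepJets (SymTables)
open Summit.QuantumFields.BalabanUV.Beta.CombChartStepJets (GcombSh ScombOf WcombOf vertexFamily₂_WcombOf)
open Summit.QuantumFields.BalabanUV.Beta.CombChartJointEnd (JsB12CombShSym)
open Summit.QuantumFields.BalabanUV.Beta.GAN24.CombesThomas (sfStep smStep)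
open Summit.QuantumFields.BalabanUV.Beta.GAN24.WSlotParityJunction (loc_oddHalf_slice parityOdd_oddHalf_slice sub_oddHalf_eq_evenHalf)
open Summit.QuantumFields.BalabanUV.Beta.GAN24.CombTowerEndOfSlots (exists_allScalesSeq_JsB12CombShSym_of_kRows_slots_parity)
open Summit.QuantumFields.BalabanUV.Beta.D1BFx.RoadEnd (d1Drift_iff_cesaro)

namespace Summit.QuantumFields.BalabanUV.Beta.GAN24.CombChartSlotJunction

noncomputable section

variable {Lc : ℕ} [NeZero Lc] {C δK cK θK Cs cS δS θS Cw cW δW θW : ℝ}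

/-! ## §1 The (III′) END's socket with the W-rows asked of the EVEN HALF only -/

/-- [folklore] **THE SLOT SOCKET OF THE (III′) END WITH THE W-ROWS ASKED OF THE EVEN HALF ONLY** (odd `Lc`, adopted units): the OWNER's
`CombTowerEndOfSlots.exists_allScalesSeq_JsB12CombShSym_of_kRows_slots_parity` at `X_j :=` the odd half of `W⁰_j = WcombOf tabs Lc⁴ (−Lc⁸∕2) cΛ Lc⁸ cB ((8N²)⁻¹ • wsym22 N) j`
(slice by slice) — its `hX` from an2's certificate `vertexFamily₂_WcombOf` (L7's `loc_oddHalf_slice`), its `hXt` hypothesis-free (`parityOdd_oddHalf_slice`), `W − X` = the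
even half (`sub_oddHalf_eq_evenHalf`) ⟹ `hW` ∕ `hWall` are asked of `unitW_j (½ • (W⁰_j + sgnK∘trK∘W⁰_j))` and NOTHING of the odd half:
K-rows of `unitK_j (GcombSh Lc j)` (leaf-02's `kSlotCombSh_holds` shape, DISPLAYED) ∧ S-rows of `unitS_j (ScombOf tabs … j)` ∧ EVEN-HALF W-rows ⟹
`∃ κ θ, 0 ≤ θ < 1 ∧ AllScalesSeq (j ↦ secondMoment (TbalOf Lc (JsB12CombShSym hLc N tabs cΛ cB) j) μ ν) κ θ`.  The (III′) twin of L7's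
`WSlotParityJunction.exists_allScalesSeq_JsRowD1_of_slots_evenHalf`.  ALL rows are HYPOTHESES («T2Shape^{ev}» ∧ «T2Drift^{ev}» at the comb-chart slot data: NOT in the tree).
CONSUMERS ALREADY IN THE TREE (located by gan24-leaf-04 g76, I-C2): the pub-balaban-gaps cell's `Gaps/D1ValueSockets` — `abs_secondMoment_TshotOf_sub_lim_mul_le_of_stepRecursion`,
`oneShotLaw_iff_lim_eq_of_stepRecursion`, `oneShotLaw_iff_forall_abs_sub_stepBal_le_of_stepRecursion`, … — take EXACTLY this conclusion as their `hall` at the record tables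
`tabs := symTablesAn1S2 3 Lc (cΛ 1)`, `cΛ := cΛ 1`, `cB := cB 1`. -/
theorem exists_allScalesSeq_JsB12CombShSym_of_kRows_slots_evenHalf (hLc : Odd Lc) (N : ℕ) (tabs : SymTables 3 Lc) (cΛ cB : ℝ)
    (hK : ∀ j, Decays (unitK (sfStep Lc j) (smStep 3 Lc j) (GcombSh (d := 3) Lc j)) C δK)
    (hKall : ∀ k j, Decays (unitK (sfStep Lc (k + j)) (smStep 3 Lc (k + j)) (GcombSh (d := 3) Lc (k + j)) -
      unitK (sfStep Lc k) (smStep 3 Lc k) (GcombSh (d := 3) Lc k)) (cK * θK ^ k) δK)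
    (hS : ∀ j, LocStencil (unitS (sfStep Lc j) (smStep 3 Lc j) (ScombOf tabs ((Lc : ℝ) ^ 4) (-((Lc : ℝ) ^ 8 / 2)) cΛ j)) Cs δS)
    (hSall : ∀ k j, LocStencil (unitS (sfStep Lc (k + j)) (smStep 3 Lc (k + j)) (ScombOf tabs ((Lc : ℝ) ^ 4) (-((Lc : ℝ) ^ 8 / 2)) cΛ (k + j)) -
      unitS (sfStep Lc k) (smStep 3 Lc k) (ScombOf tabs ((Lc : ℝ) ^ 4) (-((Lc : ℝ) ^ 8 / 2)) cΛ k)) (cS * θS ^ k) δS)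
    (hW : ∀ j, VertexFamily₂ (unitW (sfStep Lc j) (smStep 3 Lc j)
      (fun μ z ν z' => ((1 : ℝ) / 2) •
        (WcombOf tabs ((Lc : ℝ) ^ 4) (-((Lc : ℝ) ^ 8 / 2)) cΛ ((Lc : ℝ) ^ 8) cB ((8 * (N : ℝ) ^ 2)⁻¹ • wsym22 N) j μ z ν z'
          + sgnK (trK (WcombOf tabs ((Lc : ℝ) ^ 4) (-((Lc : ℝ) ^ 8 / 2)) cΛ ((Lc : ℝ) ^ 8) cB ((8 * (N : ℝ) ^ 2)⁻¹ • wsym22 N) j μ z ν z'))))) Lc Cw δW)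
    (hWall : ∀ k j, VertexFamily₂ (unitW (sfStep Lc (k + j)) (smStep 3 Lc (k + j))
        (fun μ z ν z' => ((1 : ℝ) / 2) •
          (WcombOf tabs ((Lc : ℝ) ^ 4) (-((Lc : ℝ) ^ 8 / 2)) cΛ ((Lc : ℝ) ^ 8) cB ((8 * (N : ℝ) ^ 2)⁻¹ • wsym22 N) (k + j) μ z ν z'
            + sgnK (trK (WcombOf tabs ((Lc : ℝ) ^ 4) (-((Lc : ℝ) ^ 8 / 2)) cΛ ((Lc : ℝ) ^ 8) cB ((8 * (N : ℝ) ^ 2)⁻¹ • wsym22 N) (k + j) μ z ν z')))) -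
      unitW (sfStep Lc k) (smStep 3 Lc k)
        (fun μ z ν z' => ((1 : ℝ) / 2) •
          (WcombOf tabs ((Lc : ℝ) ^ 4) (-((Lc : ℝ) ^ 8 / 2)) cΛ ((Lc : ℝ) ^ 8) cB ((8 * (N : ℝ) ^ 2)⁻¹ • wsym22 N) k μ z ν z'
            + sgnK (trK (WcombOf tabs ((Lc : ℝ) ^ 4) (-((Lc : ℝ) ^ 8 / 2)) cΛ ((Lc : ℝ) ^ 8) cB ((8 * (N : ℝ) ^ 2)⁻¹ • wsym22 N) k μ z ν z'))))) Lc
      (cW * θW ^ k) δW)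
    (hδK : 0 < δK) (hδS : 0 < δS) (hδW : 0 < δW) (hθK0 : 0 ≤ θK) (hθK1 : θK < 1) (hθS0 : 0 ≤ θS) (hθS1 : θS < 1) (hθW0 : 0 ≤ θW)
    (hθW1 : θW < 1) (μ ν : Fin 4) :
    ∃ κ θ : ℝ, 0 ≤ θ ∧ θ < 1 ∧ AllScalesSeq (fun j => B12Beta.secondMoment (TbalOf Lc (JsB12CombShSym hLc N tabs cΛ cB) j) μ ν) κ θ := by
  -- the OWNER's `hW` ∕ `hWall` rows on `W⁰_j − X j`, supplied from the even-half rows by L7's identity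
  have hWX : ∀ j, VertexFamily₂ (unitW (sfStep Lc j) (smStep 3 Lc j)
      (WcombOf tabs ((Lc : ℝ) ^ 4) (-((Lc : ℝ) ^ 8 / 2)) cΛ ((Lc : ℝ) ^ 8) cB ((8 * (N : ℝ) ^ 2)⁻¹ • wsym22 N) j -
        fun μ z ν z' => ((1 : ℝ) / 2) •
          (WcombOf tabs ((Lc : ℝ) ^ 4) (-((Lc : ℝ) ^ 8 / 2)) cΛ ((Lc : ℝ) ^ 8) cB ((8 * (N : ℝ) ^ 2)⁻¹ • wsym22 N) j μ z ν z' -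
            sgnK (trK (WcombOf tabs ((Lc : ℝ) ^ 4) (-((Lc : ℝ) ^ 8 / 2)) cΛ ((Lc : ℝ) ^ 8) cB ((8 * (N : ℝ) ^ 2)⁻¹ • wsym22 N) j μ z ν z'))))) Lc
      Cw δW := fun j => by
    rw [sub_oddHalf_eq_evenHalf]
    exact hW j
  have hWallX : ∀ k j, VertexFamily₂ (unitW (sfStep Lc (k + j)) (smStep 3 Lc (k + j))
        (WcombOf tabs ((Lc : ℝ) ^ 4) (-((Lc : ℝ) ^ 8 / 2)) cΛ ((Lc : ℝ) ^ 8) cB ((8 * (N : ℝ) ^ 2)⁻¹ • wsym22 N) (k + j) -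
          fun μ z ν z' => ((1 : ℝ) / 2) •
            (WcombOf tabs ((Lc : ℝ) ^ 4) (-((Lc : ℝ) ^ 8 / 2)) cΛ ((Lc : ℝ) ^ 8) cB ((8 * (N : ℝ) ^ 2)⁻¹ • wsym22 N) (k + j) μ z ν z' -
              sgnK (trK (WcombOf tabs ((Lc : ℝ) ^ 4) (-((Lc : ℝ) ^ 8 / 2)) cΛ ((Lc : ℝ) ^ 8) cB ((8 * (N : ℝ) ^ 2)⁻¹ • wsym22 N) (k + j) μ z ν z')))) -
      unitW (sfStep Lc k) (smStep 3 Lc k)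
        (WcombOf tabs ((Lc : ℝ) ^ 4) (-((Lc : ℝ) ^ 8 / 2)) cΛ ((Lc : ℝ) ^ 8) cB ((8 * (N : ℝ) ^ 2)⁻¹ • wsym22 N) k -
          fun μ z ν z' => ((1 : ℝ) / 2) •
            (WcombOf tabs ((Lc : ℝ) ^ 4) (-((Lc : ℝ) ^ 8 / 2)) cΛ ((Lc : ℝ) ^ 8) cB ((8 * (N : ℝ) ^ 2)⁻¹ • wsym22 N) k μ z ν z' -
              sgnK (trK (WcombOf tabs ((Lc : ℝ) ^ 4) (-((Lc : ℝ) ^ 8 / 2)) cΛ ((Lc : ℝ) ^ 8) cB ((8 * (N : ℝ) ^ 2)⁻¹ • wsym22 N) k μ z ν z'))))) Lc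
      (cW * θW ^ k) δW := fun k j => by
    rw [sub_oddHalf_eq_evenHalf, sub_oddHalf_eq_evenHalf]
    exact hWall k j
  -- `hX`: the odd half of each member is localised, from an2's own certificate of the comb-chart tables
  have hXloc : ∀ (j : ℕ) (μ ν : Fin (3 + 1)) (z : Fin (3 + 1) → ℤ), TameKernelCalculus.Loc (((1 : ℝ) / 2) •
      (WcombOf tabs ((Lc : ℝ) ^ 4) (-((Lc : ℝ) ^ 8 / 2)) cΛ ((Lc : ℝ) ^ 8) cB ((8 * (N : ℝ) ^ 2)⁻¹ • wsym22 N) j μ 0 ν z -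
        sgnK (trK (WcombOf tabs ((Lc : ℝ) ^ 4) (-((Lc : ℝ) ^ 8 / 2)) cΛ ((Lc : ℝ) ^ 8) cB ((8 * (N : ℝ) ^ 2)⁻¹ • wsym22 N) j μ 0 ν z)))) :=
    fun j μ ν z => by
    obtain ⟨Cw', δw, hδw, hW'⟩ := vertexFamily₂_WcombOf tabs ((Lc : ℝ) ^ 4) (-((Lc : ℝ) ^ 8 / 2)) cΛ ((Lc : ℝ) ^ 8) cB
      ((8 * (N : ℝ) ^ 2)⁻¹ • wsym22 N) j
    exact loc_oddHalf_slice hW' hδw μ ν z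
  exact exists_allScalesSeq_JsB12CombShSym_of_kRows_slots_parity
    (fun j μ z ν z' => ((1 : ℝ) / 2) •
      (WcombOf tabs ((Lc : ℝ) ^ 4) (-((Lc : ℝ) ^ 8 / 2)) cΛ ((Lc : ℝ) ^ 8) cB ((8 * (N : ℝ) ^ 2)⁻¹ • wsym22 N) j μ z ν z' -
        sgnK (trK (WcombOf tabs ((Lc : ℝ) ^ 4) (-((Lc : ℝ) ^ 8 / 2)) cΛ ((Lc : ℝ) ^ 8) cB ((8 * (N : ℝ) ^ 2)⁻¹ • wsym22 N) j μ z ν z'))))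
    hXloc (fun j μ ν z => parityOdd_oddHalf_slice _ μ ν z) hLc N tabs cΛ cB hK hKall hS hSall hWX hWallX hδK hδS hδW hθK0 hθK1 hθS0 hθS1
    hθW0 hθW1 μ ν

/-! ## §2 The two D1-side readings at the literal of record, on the K-, S- and even-half W-rows alone -/

/-- [folklore] **ROW D1's WALL TERM AT THE LITERAL OF RECORD IS THE VALUE IDENTITY `lim β = stepBal Nc Lc`, GIVEN THE K-, S- AND EVEN-HALF W-ROWS**: every channel
`(μ, ν)`, every colour parameter `Nc`: `D1Drift Lc (JsB12CombShSym …) Nc μ ν ↔ CauchyRate.lim (j ↦ secondMoment (TbalOf Lc (JsB12CombShSym …) j) μ ν) = stepBal Nc Lc`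
(the D1 lane's `HessKerDressedCauchy.d1Drift_iff_lim_eq` at §1's letter) — NO `hW` ∕ `hR` ∕ `hRm0` ∕ `D1Rep` letter on this reading; the value identity itself is row
D1's and is NOT proved here.  The (III′) twin of leaf-01 g78's `RowD1LiteralOfTowerEnd.d1Drift_JsRowD1Pin_iff_lim_eq` BEFORE the tower: there the rows were the (α-0)
END's theorem, here they are HYPOTHESES. -/
theorem d1Drift_JsB12CombShSym_iff_lim_eq_of_kRows_slots_evenHalf (hLc : Odd Lc) (N : ℕ) (tabs : SymTables 3 Lc) (cΛ cB : ℝ)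
    (hK : ∀ j, Decays (unitK (sfStep Lc j) (smStep 3 Lc j) (GcombSh (d := 3) Lc j)) C δK)
    (hKall : ∀ k j, Decays (unitK (sfStep Lc (k + j)) (smStep 3 Lc (k + j)) (GcombSh (d := 3) Lc (k + j)) -
      unitK (sfStep Lc k) (smStep 3 Lc k) (GcombSh (d := 3) Lc k)) (cK * θK ^ k) δK)
    (hS : ∀ j, LocStencil (unitS (sfStep Lc j) (smStep 3 Lc j) (ScombOf tabs ((Lc : ℝ) ^ 4) (-((Lc : ℝ) ^ 8 / 2)) cΛ j)) Cs δS)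
    (hSall : ∀ k j, LocStencil (unitS (sfStep Lc (k + j)) (smStep 3 Lc (k + j)) (ScombOf tabs ((Lc : ℝ) ^ 4) (-((Lc : ℝ) ^ 8 / 2)) cΛ (k + j)) -
      unitS (sfStep Lc k) (smStep 3 Lc k) (ScombOf tabs ((Lc : ℝ) ^ 4) (-((Lc : ℝ) ^ 8 / 2)) cΛ k)) (cS * θS ^ k) δS)
    (hW : ∀ j, VertexFamily₂ (unitW (sfStep Lc j) (smStep 3 Lc j)
      (fun μ z ν z' => ((1 : ℝ) / 2) •
        (WcombOf tabs ((Lc : ℝ) ^ 4) (-((Lc : ℝ) ^ 8 / 2)) cΛ ((Lc : ℝ) ^ 8) cB ((8 * (N : ℝ) ^ 2)⁻¹ • wsym22 N) j μ z ν z'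
          + sgnK (trK (WcombOf tabs ((Lc : ℝ) ^ 4) (-((Lc : ℝ) ^ 8 / 2)) cΛ ((Lc : ℝ) ^ 8) cB ((8 * (N : ℝ) ^ 2)⁻¹ • wsym22 N) j μ z ν z'))))) Lc Cw δW)
    (hWall : ∀ k j, VertexFamily₂ (unitW (sfStep Lc (k + j)) (smStep 3 Lc (k + j))
        (fun μ z ν z' => ((1 : ℝ) / 2) •
          (WcombOf tabs ((Lc : ℝ) ^ 4) (-((Lc : ℝ) ^ 8 / 2)) cΛ ((Lc : ℝ) ^ 8) cB ((8 * (N : ℝ) ^ 2)⁻¹ • wsym22 N) (k + j) μ z ν z'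
            + sgnK (trK (WcombOf tabs ((Lc : ℝ) ^ 4) (-((Lc : ℝ) ^ 8 / 2)) cΛ ((Lc : ℝ) ^ 8) cB ((8 * (N : ℝ) ^ 2)⁻¹ • wsym22 N) (k + j) μ z ν z')))) -
      unitW (sfStep Lc k) (smStep 3 Lc k)
        (fun μ z ν z' => ((1 : ℝ) / 2) •
          (WcombOf tabs ((Lc : ℝ) ^ 4) (-((Lc : ℝ) ^ 8 / 2)) cΛ ((Lc : ℝ) ^ 8) cB ((8 * (N : ℝ) ^ 2)⁻¹ • wsym22 N) k μ z ν z'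
            + sgnK (trK (WcombOf tabs ((Lc : ℝ) ^ 4) (-((Lc : ℝ) ^ 8 / 2)) cΛ ((Lc : ℝ) ^ 8) cB ((8 * (N : ℝ) ^ 2)⁻¹ • wsym22 N) k μ z ν z'))))) Lc
      (cW * θW ^ k) δW)
    (hδK : 0 < δK) (hδS : 0 < δS) (hδW : 0 < δW) (hθK0 : 0 ≤ θK) (hθK1 : θK < 1) (hθS0 : 0 ≤ θS) (hθS1 : θS < 1) (hθW0 : 0 ≤ θW)
    (hθW1 : θW < 1) (μ ν : Fin 4) (Nc : ℝ) :
    D1Drift Lc (JsB12CombShSym hLc N tabs cΛ cB) Nc μ ν ↔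
      RateCertificate.CauchyRate.lim (fun j => B12Beta.secondMoment (TbalOf Lc (JsB12CombShSym hLc N tabs cΛ cB) j) μ ν) =
        B12Normalization.stepBal Nc Lc := by
  obtain ⟨κ, θ, hθ0, hθ1, hall⟩ := exists_allScalesSeq_JsB12CombShSym_of_kRows_slots_evenHalf hLc N tabs cΛ cB hK hKall hS hSall hW hWall hδK hδS hδW
    hθK0 hθK1 hθS0 hθS1 hθW0 hθW1 μ ν
  exact d1Drift_iff_lim_eq _ hall hθ0 hθ1 Nc

/-- [folklore] **… AND A CESÀRO STATEMENT** (`D1BFx.RoadEnd.d1Drift_iff_cesaro` at the same letter): `D1Drift Lc (JsB12CombShSym …) Nc μ ν ⟺ (Σ_{j<m} β_j)∕m → stepBal Nc Lc`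
— road «BF-x»'s MEAN-grading socket at the literal of record; the (III′) twin of L7's `d1Drift_JsRowD1Pin_iff_cesaro_of_slots_evenHalf` with the K-side displayed. -/
theorem d1Drift_JsB12CombShSym_iff_cesaro_of_kRows_slots_evenHalf (hLc : Odd Lc) (N : ℕ) (tabs : SymTables 3 Lc) (cΛ cB : ℝ)
    (hK : ∀ j, Decays (unitK (sfStep Lc j) (smStep 3 Lc j) (GcombSh (d := 3) Lc j)) C δK)
    (hKall : ∀ k j, Decays (unitK (sfStep Lc (k + j)) (smStep 3 Lc (k + j)) (GcombSh (d := 3) Lc (k + j)) -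
      unitK (sfStep Lc k) (smStep 3 Lc k) (GcombSh (d := 3) Lc k)) (cK * θK ^ k) δK)
    (hS : ∀ j, LocStencil (unitS (sfStep Lc j) (smStep 3 Lc j) (ScombOf tabs ((Lc : ℝ) ^ 4) (-((Lc : ℝ) ^ 8 / 2)) cΛ j)) Cs δS)
    (hSall : ∀ k j, LocStencil (unitS (sfStep Lc (k + j)) (smStep 3 Lc (k + j)) (ScombOf tabs ((Lc : ℝ) ^ 4) (-((Lc : ℝ) ^ 8 / 2)) cΛ (k + j)) -
      unitS (sfStep Lc k) (smStep 3 Lc k) (ScombOf tabs ((Lc : ℝ) ^ 4) (-((Lc : ℝ) ^ 8 / 2)) cΛ k)) (cS * θS ^ k) δS)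
    (hW : ∀ j, VertexFamily₂ (unitW (sfStep Lc j) (smStep 3 Lc j)
      (fun μ z ν z' => ((1 : ℝ) / 2) •
        (WcombOf tabs ((Lc : ℝ) ^ 4) (-((Lc : ℝ) ^ 8 / 2)) cΛ ((Lc : ℝ) ^ 8) cB ((8 * (N : ℝ) ^ 2)⁻¹ • wsym22 N) j μ z ν z'
          + sgnK (trK (WcombOf tabs ((Lc : ℝ) ^ 4) (-((Lc : ℝ) ^ 8 / 2)) cΛ ((Lc : ℝ) ^ 8) cB ((8 * (N : ℝ) ^ 2)⁻¹ • wsym22 N) j μ z ν z'))))) Lc Cw δW)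
    (hWall : ∀ k j, VertexFamily₂ (unitW (sfStep Lc (k + j)) (smStep 3 Lc (k + j))
        (fun μ z ν z' => ((1 : ℝ) / 2) •
          (WcombOf tabs ((Lc : ℝ) ^ 4) (-((Lc : ℝ) ^ 8 / 2)) cΛ ((Lc : ℝ) ^ 8) cB ((8 * (N : ℝ) ^ 2)⁻¹ • wsym22 N) (k + j) μ z ν z'
            + sgnK (trK (WcombOf tabs ((Lc : ℝ) ^ 4) (-((Lc : ℝ) ^ 8 / 2)) cΛ ((Lc : ℝ) ^ 8) cB ((8 * (N : ℝ) ^ 2)⁻¹ • wsym22 N) (k + j) μ z ν z')))) -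
      unitW (sfStep Lc k) (smStep 3 Lc k)
        (fun μ z ν z' => ((1 : ℝ) / 2) •
          (WcombOf tabs ((Lc : ℝ) ^ 4) (-((Lc : ℝ) ^ 8 / 2)) cΛ ((Lc : ℝ) ^ 8) cB ((8 * (N : ℝ) ^ 2)⁻¹ • wsym22 N) k μ z ν z'
            + sgnK (trK (WcombOf tabs ((Lc : ℝ) ^ 4) (-((Lc : ℝ) ^ 8 / 2)) cΛ ((Lc : ℝ) ^ 8) cB ((8 * (N : ℝ) ^ 2)⁻¹ • wsym22 N) k μ z ν z'))))) Lc
      (cW * θW ^ k) δW)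
    (hδK : 0 < δK) (hδS : 0 < δS) (hδW : 0 < δW) (hθK0 : 0 ≤ θK) (hθK1 : θK < 1) (hθS0 : 0 ≤ θS) (hθS1 : θS < 1) (hθW0 : 0 ≤ θW)
    (hθW1 : θW < 1) (μ ν : Fin 4) (Nc : ℝ) :
    D1Drift Lc (JsB12CombShSym hLc N tabs cΛ cB) Nc μ ν ↔
      Tendsto (fun m : ℕ => (∑ j ∈ range m, B12Beta.secondMoment (TbalOf Lc (JsB12CombShSym hLc N tabs cΛ cB) j) μ ν) / (m : ℝ)) atTop
        (𝓝 (B12Normalization.stepBal Nc Lc)) := by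
  obtain ⟨κ, θ, hθ0, hθ1, hall⟩ := exists_allScalesSeq_JsB12CombShSym_of_kRows_slots_evenHalf hLc N tabs cΛ cB hK hKall hS hSall hW hWall hδK hδS hδW
    hθK0 hθK1 hθS0 hθS1 hθW0 hθW1 μ ν
  exact d1Drift_iff_cesaro _ hall hθ0 hθ1 Nc

end

end Summit.QuantumFields.BalabanUV.Beta.GAN24.CombChartSlotJunction
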